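import Summits.QuantumAdvantage.QuantumAdvantage.Theorems.CubicForrelationNearExactIsExactTwelveTypeOWindowPrep

/-!
# Crux `CubicForrelation.NearExactIsExact` (stmt-QuantumAdvantage-14043) — n = 12, INSIDE the open window: a TYPE-O side forces `Φ ≤ 59/64`

Certificate seat `b2b-cforr-cert` (gen 12).  HONEST FRAMING: a kernel-checked THEOREM about cubic Boolean pairs on 12 bits — the first
two-sided statement strictly inside the open window `θ₁₂ ∈ [57/64, 15/16)` (`theta_twelve_halfopen`); it does NOT move `θ₁₂` (the
type-E sides at levels 5 and `≥ 6` are untouched) and it is NOT summit progress.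

THEOREM `to12_typeO_le`: for cubic `f, g : 𝔽₂¹² → 𝔽₂` with `W_g = 16u` and some (equivalently every) `u(x)` odd — `g` of TYPE O —
`Φ(f,g) ≤ 59/64 = 944/1024`.  (The tree had: one-sided `Φ ≤ 15/16` for type O, `typeO_capacity_15_16`; two-sided `Φ ≠ 15/16`,
`tw12_typeO_false`.)  COROLLARY `to12_window_typeE`: a cubic pair on 12 bits with `59/64 < Φ < 1` has BOTH Walsh spectra in `32ℤ`
(both sides of type E), so the fifteen candidate values `945/1024, …, 959/1024` of `θ₁₂` can only be realised by type-E pairs.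

## Proof: a RELATIVE 2-adic tower on the wild points (new device)

With `s = (−1)^f`, `τ = u − 4s`, budget `Σ τ² = 2¹⁷(1 − Φ) < 10240 = 2.5·2¹²` for `Φ > 59/64` (`tw12_budget`).  Digits (`z2_digitOne/Two`):
`u ≡ 1 + 2d₁ + 4d₂ (mod 8)` with `d₁` AFFINE, `d₂` CUBIC; `E = {d₁ = d₂}` is the support of a non-zero cubic (`no_caseA`), `#E ≥ 512`.
* BASE PATTERN.  `τ ≡ τ₀ := (−1)^{d₁}(1 − 4·1_E) (mod 8)` pointwise, whatever the partner `f` is (`to12_pt_mod8`): `τ = τ₀ + 8v` with an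
  integer "wild" function `v`, and `τ² − τ₀² = 16v(τ₀ + 4v) ≥ 16|v|(4|v| − 3)` (`to12_excess`): `≥ 16, 160, 832, 3712` for `|v| ≥ 1, 2, 4, 8`.
* `#E = 512`.  `Σ τ₀² = 2¹² + 8#E ≤ Σ τ² < 2.5·2¹²` gives `#E < 768 = 3·2⁸`, so by the second-weight brick `sw_cubic_second_weight`
  (`…SecondWeight.lean`: no cubic weight in `(2^{m−3}, 3·2^{m−4})`) `#E = 512` and `E` is a 9-flat `x_E ⊕ V_E` (`mw_flat_of_minweight`).
* CUBE CONGRUENCES.  On every coordinate cube `C_I`, `|I| = k`: `Σ_{C_I} u ∈ 2^{k−4+⌈(12−k)/3⌉}ℤ` (Poisson + Ax, `cube_sum_dvd`), `4Σ_{C_I} s ∈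
  2^{⌈k/3⌉+2}ℤ` (Ax), `Σ_{C_I} (−1)^{d₁} ∈ 2^k ℤ` (Ax, degree 1) and — the flat input — `Σ_{C_I ∩ E} (−1)^{d₁} ∈ 2^{k−3}ℤ` (`to12_flat_char_dvd`:
  `C_I ∩ E` is empty or a coset of the xor-closed `C_I ∩ V_E`, which has `≥ 2^{k−3}` elements by `#C_I·#V_E ≤ 2¹²·#(C_I ∩ V_E)`, and an affine
  character sums to `0` or `±#(C_I ∩ V_E)` over such a coset).  Hence `Σ_{C_I} 8v = Σ_{C_I} τ − Σ_{C_I} τ₀` is `≡ 0 (mod 16)` for `k ≥ 5`,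
  `(mod 32)` for `k ≥ 7`, `(mod 64)` for `k ≥ 10` (`to12_cube_congr`).
* TOWER (`to12_level`).  `Σ_{C_I} v` even for `|I| ≥ 5` ⇒ `[v odd]` has degree `≤ 4` (Möbius, `bb_moebius_isDegLeFun`) ⇒ it has `≥ 256` points
  or none (Reed–Muller); `256·16 = 2¹² >` the excess budget `Σ(τ² − τ₀²) < 2048`, so `v` is even; then `[v/2 odd]` has degree `≤ 6` (cubes
  `|I| ≥ 7`), `≥ 64` points at `≥ 160` each — too expensive; then `[v/4 odd]` has degree `≤ 9`, `≥ 8` points at `≥ 832` — too expensive; finally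
  every point with `v ≠ 0` has `|v| ≥ 8` and costs `≥ 3712 > 2048`.  So `v ≡ 0`, `Σ τ² = Σ τ₀² = 2¹³`, `Φ = 15/16` exactly — excluded by
  `tw12_isolation_ge` (`Φ ≥ 15/16 ⇒ Φ = 1`).
What does NOT follow: nothing for `Φ ≤ 59/64` (there `#E = 768` becomes affordable and `τ₀` no longer satisfies the cube congruences), and
nothing for type-E sides (there the base pattern carries an undetermined sign digit).  The excess thresholds actually give more: a type-O
side with `#E = 512` has `1024Φ ∈ {960} ∪ {931, 929} ∪ (−∞, 928]` — recorded here, not formalised.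

References: J. Ax (1964) / R. J. McEliece (1972); T. Kasami, N. Tokura (1970); MacWilliams–Sloane (1977) Ch. 13–15; R. O'Donnell (2014)
§3.3.  Everything below is proved from Mathlib and the tree; axioms are the standard three.
-/

set_option linter.dupNamespace false -- D-0017: single-problem summit ⇒ `QuantumAdvantage.QuantumAdvantage` by design

noncomputable section

namespace Summit.QuantumAdvantage.QuantumAdvantage.Theorems.CubicForrelation.NearExactIsExact

open Finset
open Literature.Computability.QuantumComplexity
open Literature.Computability.QuantumComplexity.BuzetChailloux (bxor zeroVec bxor_bxor_cancel_left bxor_zeroVec zeroVec_bxor bxor_comm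
  bxor_self)
open Literature.Computability.QuantumComplexity.DerivativeWalsh (W)
open Summit.QuantumAdvantage.QuantumAdvantage.Theorems.NearExactIsExact.Negative (TypeOTwelve.no_caseA TypeOTwelve.cube_sum_dvd
  TypeOTwelve.typeO_of_exists_odd)

/-! ### The theorem -/

/-- **A type-O side forces `Φ ≤ 59/64` on 12 bits.**  For cubic `f, g : 𝔽₂¹² → 𝔽₂` with `W_g = 16u` and some `u(x)` odd:
`Φ(f,g) ≤ 59/64`.  Finite-slice statement inside the open window `θ₁₂ ∈ [57/64, 15/16)`; NOT summit progress. [this work] -/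
theorem to12_typeO_le (f g : (Fin (6 + 6) → Bool) → Bool) (hf : IsDegLeFun 3 f) (hg : IsDegLeFun 3 g)
    (u : (Fin (6 + 6) → Bool) → ℤ) (hu : ∀ x, W (fun y => signOf (g y)) x = (2 : ℝ) ^ 4 * (u x : ℝ))
    (hodd : ∃ x, Odd (u x)) : forrelation f g ≤ 59 / 64 := by
  classical
  by_contra hΦ
  push Not at hΦ
  have hall : ∀ x, Odd (u x) := TypeOTwelve.typeO_of_exists_odd g u hg hu hodd
  have hu' : ∀ x, W (fun y => signOf (g y)) x = (2 : ℝ) ^ (2 * 2) * (u x : ℝ) := fun x => (hu x).trans (by norm_num)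
  have hd1 : IsDegLeFun 1 (fun x => decide (Odd (u x / 2))) := z2_digitOne 2 g u hg hu' hall
  have hd2 : IsDegLeFun 3 (fun x => decide (Odd (u x / 2 / 2))) := z2_digitTwo 2 g u hg hu' hall
  -- case A (all `u ≡ ±3 (mod 8)`) is empty
  have hnoA : ¬ (∀ x, ¬ (Odd (u x / 2) ↔ Odd (u x / 2 / 2))) := by
    intro h
    refine TypeOTwelve.no_caseA g u hg hu fun x => ?_
    have h0 := Int.odd_iff.1 (hall x)
    have hx := h x
    rw [Int.odd_iff, Int.odd_iff] at hx
    omega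
  set E := univ.filter (fun x : Fin (6 + 6) → Bool => (Odd (u x / 2) ↔ Odd (u x / 2 / 2))) with hEdef
  have hmemE : ∀ x, x ∈ E ↔ (Odd (u x / 2) ↔ Odd (u x / 2 / 2)) := fun x => by simp [hEdef]
  have hdegE : IsDegLeFun (2 + 1) (fun x => (decide (Odd (u x / 2)) ^^ decide (Odd (u x / 2 / 2))) ^^ true) :=
    tb_isDegLeFun_xor_const (bb_isDegLeFun_bxor (hd1.mono (by norm_num)) hd2) true
  have hsetE : (univ.filter fun x : Fin (6 + 6) → Bool =>
      ((decide (Odd (u x / 2)) ^^ decide (Odd (u x / 2 / 2))) ^^ true) = true) = E := by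
    rw [hEdef]
    apply filter_congr
    intro x _
    by_cases h1 : Odd (u x / 2) <;> by_cases h2 : Odd (u x / 2 / 2) <;> simp [h1, h2]
  have hne : ∃ x, ((decide (Odd (u x / 2)) ^^ decide (Odd (u x / 2 / 2))) ^^ true) = true := by
    by_contra hnone
    push Not at hnone
    refine hnoA fun x => ?_
    have hx := hnone x
    by_cases h1 : Odd (u x / 2) <;> by_cases h2 : Odd (u x / 2 / 2) <;> simp [h1, h2] at hx ⊢
  have hsumE : (∑ x, (if (Odd (u x / 2) ↔ Odd (u x / 2 / 2)) then 1 else 0 : ℤ)) = #E := by rw [sum_boole]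
  -- budget `Σ τ² = 2¹⁷(1 − Φ) < 10240`
  have hbud := tw12_budget f g u hu
  have hT : (∑ x, (u x - 4 * sZ (f x)) ^ 2 : ℤ) < 10240 := by
    have h' : ((∑ x, (u x - 4 * sZ (f x)) ^ 2 : ℤ) : ℝ) < 10240 := by rw [hbud]; norm_num at hΦ ⊢; linarith
    exact_mod_cast h'
  -- base pattern `τ₀` and wild function `v`: `τ = τ₀ + 8v`
  choose v hv using fun x => to12_pt_mod8 (u x) (sZ (f x)) (hall x) (tp_sZ_cases (f x))
  set τ₀ : (Fin (6 + 6) → Bool) → ℤ := fun x =>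
    sZ (decide (Odd (u x / 2))) * (1 - 4 * (if (Odd (u x / 2) ↔ Odd (u x / 2 / 2)) then 1 else 0)) with hτ₀def
  have hvx : ∀ x, u x - 4 * sZ (f x) = τ₀ x + 8 * v x := fun x => hv x
  have hτ₀val : ∀ x, τ₀ x = 1 ∨ τ₀ x = -1 ∨ τ₀ x = 3 ∨ τ₀ x = -3 := by
    intro x
    simp only [τ₀]
    rcases tp_sZ_cases (decide (Odd (u x / 2))) with h | h <;> rw [h] <;> split_ifs <;> norm_num
  have hτ₀sq : ∀ x, τ₀ x ^ 2 = 1 + 8 * (if (Odd (u x / 2) ↔ Odd (u x / 2 / 2)) then 1 else 0 : ℤ) := by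
    intro x
    simp only [τ₀]
    rcases tp_sZ_cases (decide (Odd (u x / 2))) with h | h <;> rw [h] <;> split_ifs <;> norm_num
  have hsumτ₀ : ∑ x, τ₀ x ^ 2 = 4096 + 8 * #E := by
    rw [sum_congr rfl fun x _ => hτ₀sq x, sum_add_distrib, ← mul_sum, hsumE, sum_const, card_univ, Fintype.card_fun,
      Fintype.card_bool, Fintype.card_fin]
    norm_num
  -- excess decomposition `Σ τ² = Σ τ₀² + Σ X`, `X ≥ 0`
  set X : (Fin (6 + 6) → Bool) → ℤ := fun x => (τ₀ x + 8 * v x) ^ 2 - τ₀ x ^ 2 with hXdef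
  have hXnn : ∀ x, 0 ≤ X x := fun x => to12_excess_nonneg _ _ (hτ₀val x)
  have hTdec : (∑ x, (u x - 4 * sZ (f x)) ^ 2 : ℤ) = ∑ x, τ₀ x ^ 2 + ∑ x, X x := by
    rw [← sum_add_distrib]
    exact sum_congr rfl fun x _ => by rw [hvx x]; simp only [X]; ring
  have hXsum_nn : 0 ≤ ∑ x, X x := sum_nonneg fun x _ => hXnn x
  -- `#E = 512`
  have hE16 : 16 * #E < 3 * 2 ^ (6 + 6) := by
    have h1 : (4096 : ℤ) + 8 * #E < 10240 := by linarith
    have h2 : (#E : ℤ) < 768 := by linarith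
    have h3 : #E < 768 := by exact_mod_cast h2
    norm_num; omega
  have hE512 : #E = 512 := by
    have h := sw_cubic_second_weight (m := 6 + 6) _ hdegE hne (by rw [hsetE]; exact hE16)
    rw [hsetE] at h
    norm_num at h
    omega
  have hXsum : ∑ x, X x < 2048 := by
    have : (∑ x, (u x - 4 * sZ (f x)) ^ 2 : ℤ) = 8192 + ∑ x, X x := by rw [hTdec, hsumτ₀, hE512]; norm_num
    linarith
  -- `E` is a 9-flat
  have hmwE := mw_flat_of_minweight 2 _ hdegE (by rw [hsetE, hE512]; norm_num)
  rw [hsetE] at hmwE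
  obtain ⟨h0E, haddE, hcardVE, hcosetE⟩ := hmwE
  set VE := univ.filter (fun a : Fin (6 + 6) → Bool => ∀ x,
    ((decide (Odd (u (bxor x a) / 2)) ^^ decide (Odd (u (bxor x a) / 2 / 2))) ^^ true) =
      ((decide (Odd (u x / 2)) ^^ decide (Odd (u x / 2 / 2))) ^^ true)) with hVE
  rw [hE512] at hcardVE
  have hEpos : 0 < #E := by rw [hE512]; norm_num
  obtain ⟨xE, hxE⟩ : E.Nonempty := card_pos.1 hEpos
  have hSE : E = VE.image (bxor xE) := hcosetE xE (by
    have h := (hmemE xE).1 hxE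
    by_cases h1 : Odd (u xE / 2)
    · have h2 : Odd (u xE / 2 / 2) := h.1 h1
      simp [h1, h2]
    · have h2 : ¬ Odd (u xE / 2 / 2) := fun h' => h1 (h.2 h')
      simp [h1, h2])
  -- the wild identity in coset form
  have hv' : ∀ x, u x - 4 * sZ (f x) =
      sZ (decide (Odd (u x / 2))) * (1 - 4 * (if x ∈ VE.image (bxor xE) then 1 else 0)) + 8 * v x := by
    intro x
    rw [← hSE, hvx x]
    simp only [τ₀]
    by_cases hx : (Odd (u x / 2) ↔ Odd (u x / 2 / 2))
    · rw [if_pos hx, if_pos ((hmemE x).2 hx)]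
    · rw [if_neg hx, if_neg (fun h' => hx ((hmemE x).1 h'))]
  have hcc := fun I => to12_cube_congr f g hf hg u hu hd1 VE xE h0E haddE hcardVE v hv' I
  -- excess of a set of wild points
  have hXset : ∀ (S : Finset (Fin (6 + 6) → Bool)) (c : ℤ), 1 ≤ c → (∀ x ∈ S, c ≤ v x ∨ v x ≤ -c) →
      16 * c * (4 * c - 3) * #S ≤ ∑ x, X x := by
    intro S c hc hS
    calc 16 * c * (4 * c - 3) * #S = ∑ x ∈ S, 16 * c * (4 * c - 3) := by rw [sum_const, nsmul_eq_mul, mul_comm]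
      _ ≤ ∑ x ∈ S, X x := sum_le_sum fun x hx => to12_excess _ _ c (hτ₀val x) hc (hS x hx)
      _ ≤ ∑ x, X x := sum_le_sum_of_subset_of_nonneg (subset_univ _) fun x _ _ => hXnn x
  -- LEVEL 1: `v` is even
  have hv2 : ∀ x, Even (v x) := by
    rcases to12_level v 4 (fun I hI => (hcc I).1 (by omega)) with h | h
    · exact h
    · exfalso
      have hcnt : (256 : ℤ) ≤ #(univ.filter fun x => Odd (v x)) := by norm_num at h; exact_mod_cast (by omega)
      have hge := hXset (univ.filter fun x => Odd (v x)) 1 le_rfl (fun x hx => by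
        obtain ⟨k, hk⟩ := (mem_filter.1 hx).2; omega)
      linarith
  choose v₁ hv₁ using hv2
  have hvv₁ : ∀ x, v x = 2 * v₁ x := fun x => by rw [two_mul]; exact hv₁ x
  -- LEVEL 2: `v/2` is even
  have hv4 : ∀ x, Even (v₁ x) := by
    rcases to12_level v₁ 6 (fun I hI => by
      have h4 := (hcc I).2.1 (by omega)
      rw [sum_congr rfl (fun x _ => hvv₁ x), ← mul_sum] at h4
      omega) with h | h
    · exact h
    · exfalso
      have hcnt : (64 : ℤ) ≤ #(univ.filter fun x => Odd (v₁ x)) := by norm_num at h; exact_mod_cast (by omega)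
      have hge := hXset (univ.filter fun x => Odd (v₁ x)) 2 (by norm_num) (fun x hx => by
        obtain ⟨k, hk⟩ := (mem_filter.1 hx).2; have := hvv₁ x; omega)
      linarith
  choose v₂ hv₂ using hv4
  have hvv₂ : ∀ x, v x = 4 * v₂ x := fun x => by rw [hvv₁ x, hv₂ x]; ring
  -- LEVEL 3: `v/4` is even
  have hv8 : ∀ x, Even (v₂ x) := by
    rcases to12_level v₂ 9 (fun I hI => by
      have h8 := (hcc I).2.2 (by omega)
      rw [sum_congr rfl (fun x _ => hvv₂ x), ← mul_sum] at h8
      omega) with h | h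
    · exact h
    · exfalso
      have hcnt : (8 : ℤ) ≤ #(univ.filter fun x => Odd (v₂ x)) := by norm_num at h; exact_mod_cast (by omega)
      have hge := hXset (univ.filter fun x => Odd (v₂ x)) 4 (by norm_num) (fun x hx => by
        obtain ⟨k, hk⟩ := (mem_filter.1 hx).2; have := hvv₂ x; omega)
      linarith
  -- LEVEL 4: no wild point at all
  have hv0 : ∀ x, v x = 0 := by
    intro x
    by_contra hx
    have h8 : 8 ≤ v x ∨ v x ≤ -8 := by obtain ⟨k, hk⟩ := hv8 x; have := hvv₂ x; omega
    have h1 := to12_excess _ _ 8 (hτ₀val x) (by norm_num) h8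
    have h2 : X x ≤ ∑ y, X y := single_le_sum (fun y _ => hXnn y) (mem_univ x)
    simp only [X] at h2
    linarith
  -- hence `Σ τ² = 8192`, `Φ = 15/16`, contradicting `tw12_isolation_ge`
  have hT8192 : (∑ x, (u x - 4 * sZ (f x)) ^ 2 : ℤ) = 8192 := by
    rw [hTdec, hsumτ₀, hE512, sum_eq_zero (fun x _ => by simp only [X]; rw [hv0 x]; ring)]
    norm_num
  have hΦeq : forrelation f g = 15 / 16 := by
    have h : ((∑ x, (u x - 4 * sZ (f x)) ^ 2 : ℤ) : ℝ) = 8192 := by exact_mod_cast hT8192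
    rw [hbud] at h
    linarith
  have h1 := tw12_isolation_ge f g hf hg (by rw [hΦeq])
  rw [hΦeq] at h1
  norm_num at h1

/-- **The same at the literal type `Fin 12`, hypothesis-free form**: if some `W_g(x)/16` is odd then `Φ(f,g) ≤ 59/64`. [this work] -/
theorem typeO_le_59_64 : ∀ f g : (Fin 12 → Bool) → Bool, IsDegLeFun 3 f → IsDegLeFun 3 g →
    (∃ x, ∃ k : ℤ, W (fun y => signOf (g y)) x = 16 * (2 * (k : ℝ) + 1)) → forrelation f g ≤ 59 / 64 := by
  intro f g hf hg hx
  obtain ⟨u, hu⟩ := tw_base (n := 6 + 6) g hg 4 (by norm_num)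
  obtain ⟨x, k, hk⟩ := hx
  refine to12_typeO_le f g hf hg u hu ⟨x, ⟨k, ?_⟩⟩
  have h := (hu x).symm.trans hk
  have h' : ((u x : ℤ) : ℝ) = ((2 * k + 1 : ℤ) : ℝ) := by push_cast; linarith
  exact_mod_cast h'

/-- **Corollary: the upper part of the window is type E on both sides.**  If cubic `f, g : 𝔽₂¹² → 𝔽₂` have `59/64 < Φ(f,g) < 1`, then
every Walsh value of `g` AND of `f` lies in `32ℤ` (`W/16` even everywhere).  NOT summit progress. [this work] -/
theorem to12_window_typeE (f g : (Fin (6 + 6) → Bool) → Bool) (hf : IsDegLeFun 3 f) (hg : IsDegLeFun 3 g)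
    (hlo : (59 / 64 : ℝ) < forrelation f g) :
    (∀ x, ∃ k : ℤ, W (fun y => signOf (g y)) x = 32 * (k : ℝ)) ∧ (∀ x, ∃ k : ℤ, W (fun y => signOf (f y)) x = 32 * (k : ℝ)) := by
  have key : ∀ f g : (Fin (6 + 6) → Bool) → Bool, IsDegLeFun 3 f → IsDegLeFun 3 g → (59 / 64 : ℝ) < forrelation f g →
      ∀ x, ∃ k : ℤ, W (fun y => signOf (g y)) x = 32 * (k : ℝ) := by
    intro f g hf hg hlo x
    obtain ⟨u, hu⟩ := tw_base (n := 6 + 6) g hg 4 (by norm_num)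
    have hev : ∀ x, Even (u x) := by
      intro x
      by_contra hx
      have h := to12_typeO_le f g hf hg u hu ⟨x, Int.not_even_iff_odd.1 hx⟩
      linarith
    obtain ⟨k, hk⟩ := hev x
    refine ⟨k, ?_⟩
    rw [hu x, hk]; push_cast; ring
  refine ⟨key f g hf hg hlo, key g f hg hf ?_⟩
  rwa [Summit.QuantumAdvantage.QuantumAdvantage.Theorems.SignedCubicForrelationNotPrBPP.Negative.HalfQuad.forrelation_comm]

end Summit.QuantumAdvantage.QuantumAdvantage.Theorems.CubicForrelation.NearExactIsExact

end
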